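import Literature.Probability.Percolation.FKLoopWindingCells

/-!
# Stub `s17_strandTurning` of line `rainbow-monomials-in-excursion-kernels` — Part 1:
# two strands closed by a common return walk turn by the same amount
# (crux `BoundaryDefectGaussianR`, stmt-CriticalPhenomena-14132; insertion dictionary D2, T6)

Model-free core of T6 (the turning number of a strand between two ends does not depend on the
configuration). Two strands of the turning rules `nextCorner β`, `nextCorner β'` start at the same
corner `e` and reach the same corner `b` after `n`, resp. `n'`, steps; both are closed up by ONE
common list of corners `rs = [b, r₁, …, r_k]` whose darts (`cornerDart`, the darts of the oriented
medial graph of `MedialTrailUmlaufsatz` / `FKLoopWindingCells`) are consecutive and return to the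
medial position `cpos e` of `e`. If the two resulting cyclic dart lists have no repeated dart they
are closed TRAILS of the oriented medial graph, so by the combinatorial Umlaufsatz
(`MedialTrail.inv_of_isTrail`) each turns by `+4` with winding numbers in `{0, 1}` or by `-4` with
winding numbers in `{0, -1}`; the turning number of each is the strand's `∑ turnSign` plus a
contribution of the common return part, the SAME for both (`s17_st1_trail`); and if the partial
winding numbers of the two strands agree on a face beside a dart of the common part, the two trails
are of the same type (`MedialTrail.INV.rf_cases`), hence the two strand sums agree
(`s17_strandTurning_part1`, registered). Everything is proved; no new definitions.
-/

namespace Summit.CriticalPhenomena.CardyFormulaZ2.Cruxes.BoundaryDefectGaussianR.RainbowMonomialsInExcursionKernels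

open Literature.Probability.LatticeModels Literature.Probability.LatticeModels.MedialTrail
open Literature.Probability.Percolation

/-- `getD` just after a prefix. [folklore] -/
theorem s17_st1_getD_append_cons {α : Type*} (l : List α) (x y d : α) :
    (l ++ [x, y]).getD l.length d = x ∧ (l ++ [x, y]).getD (l.length + 1) d = y := by
  constructor
  · rw [List.getD_append_right _ _ _ _ le_rfl, Nat.sub_self]; rfl
  · rw [List.getD_append_right _ _ _ _ (by omega), show l.length + 1 - l.length = 1 by omega]; rfl

section Generic

variable {β : BondConfig (Site 2)} {e : Site 2 × Fin 4} {n : ℕ} {rs : List (Site 2 × Fin 4)}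
  {σ : ℕ → Site 2 × Fin 4}

/-- The extended corner sequence agrees with the strand up to index `n`. [folklore] -/
theorem s17_st1_sigma_le (hσ : ∀ m, σ m = if m < n then (nextCorner β)^[m] e else (rs ++ [e, nextCorner β e]).getD (m - n) e)
    (hhead : rs.head? = some ((nextCorner β)^[n] e)) {m : ℕ} (hm : m ≤ n) :
    σ m = (nextCorner β)^[m] e := by
  rw [hσ]
  by_cases h : m < n
  · rw [if_pos h]
  · have hmn : m = n := le_antisymm hm (not_lt.1 h)
    subst hmn
    rw [if_neg h, Nat.sub_self]
    obtain ⟨b, L, rfl⟩ : ∃ b L, rs = b :: L := by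
      cases rs with
      | nil => simp at hhead
      | cons b L => exact ⟨b, L, rfl⟩
    simp only [List.head?_cons, Option.some.injEq] at hhead
    simp [hhead]

/-- **Consecutive darts.** Along the extended corner sequence (strand, then return corners, then
`e` and its successor) every position is the head of the previous dart. [folklore] -/
theorem s17_st1_sigma_succ (hσ : ∀ m, σ m = if m < n then (nextCorner β)^[m] e else (rs ++ [e, nextCorner β e]).getD (m - n) e)
    (hhead : rs.head? = some ((nextCorner β)^[n] e))
    (hchain : List.IsChain (fun c c' => (cornerDart c).2 = cpos c') rs)
    (hlast : ∀ c, rs.getLast? = some c → (cornerDart c).2 = cpos e) {m : ℕ} (hm : m ≤ n + rs.length) :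
    cpos (σ (m + 1)) = (cornerDart (σ m)).2 := by
  rcases Nat.lt_or_ge m n with h | h
  · -- inside the strand
    rw [s17_st1_sigma_le hσ hhead (Nat.succ_le_of_lt h), s17_st1_sigma_le hσ hhead h.le, cornerDart_eq β,
      Function.iterate_succ_apply']
  · obtain ⟨j, rfl⟩ := Nat.exists_eq_add_of_le h
    rw [hσ (n + j + 1), hσ (n + j), if_neg (by omega), if_neg (by omega), show n + j + 1 - n = j + 1 by omega,
      Nat.add_sub_cancel_left]
    have hk : j ≤ rs.length := by omega
    rcases Nat.lt_or_ge (j + 1) rs.length with hj | hj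
    · -- two consecutive return corners
      rw [List.getD_append _ _ _ _ hj, List.getD_append _ _ _ _ (by omega), List.getD_eq_getElem _ _ hj,
        List.getD_eq_getElem _ _ (by omega)]
      exact (List.isChain_iff_getElem.1 hchain j hj).symm
    · rcases Nat.lt_or_ge j rs.length with hj' | hj'
      · -- the last return corner, then `e`
        have hj1 : j + 1 = rs.length := by omega
        rw [hj1, (s17_st1_getD_append_cons rs e (nextCorner β e) e).1, List.getD_append _ _ _ _ hj',
          List.getD_eq_getElem _ _ hj']
        refine (hlast _ ?_).symm
        rw [List.getLast?_eq_getElem?, ← hj1, Nat.add_sub_cancel, List.getElem?_eq_getElem hj']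
      · -- `e`, then its successor
        have hj0 : j = rs.length := le_antisymm hk hj'
        subst hj0
        rw [(s17_st1_getD_append_cons rs e (nextCorner β e) e).1, (s17_st1_getD_append_cons rs e (nextCorner β e) e).2,
          cornerDart_eq β]

/-- **The closed trail of a strand and its return walk.** For a strand `e, σe, …, σⁿe = b` of the
turning rule `σ = nextCorner β` (`n ≥ 1`) and return corners `rs = [b, r₁, …]` with consecutive
darts ending at `cpos e`, such that the darts of the strand and of `rs` are pairwise distinct: the
cyclic list of medial positions is a closed trail of the oriented medial graph, its darts are those
of the strand followed by those of `rs` (so its winding number is the sum of the two partial winding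
numbers), and its turning number is `∑_{m<n} turnSign β (σᵐ e)` plus a quantity depending only on
`rs` and `e`. [cite: Hopf1935, Satz I] -/
theorem s17_st1_trail (hσ : ∀ m, σ m = if m < n then (nextCorner β)^[m] e else (rs ++ [e, nextCorner β e]).getD (m - n) e)
    (hn : 1 ≤ n) (hhead : rs.head? = some ((nextCorner β)^[n] e))
    (hchain : List.IsChain (fun c c' => (cornerDart c).2 = cpos c') rs)
    (hlast : ∀ c, rs.getLast? = some c → (cornerDart c).2 = cpos e)
    (hnodup : ((List.range n).map (fun m => cornerDart ((nextCorner β)^[m] e)) ++ rs.map cornerDart).Nodup) :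
    IsTrail ((List.range (n + rs.length)).map (fun m => cpos (σ m))) ∧
      cdarts ((List.range (n + rs.length)).map (fun m => cpos (σ m))) =
        (List.range n).map (fun m => cornerDart ((nextCorner β)^[m] e)) ++ rs.map cornerDart ∧
      cturn ((List.range (n + rs.length)).map (fun m => cpos (σ m))) =
        ∑ m ∈ Finset.range n, turnSign β ((nextCorner β)^[m] e) +
          ∑ j ∈ Finset.range rs.length,
            turn (((rs ++ [e]).map cpos ++ [((cpos e).1 + (cdir e.2).1, (cpos e).2 + (cdir e.2).2)]).getD j (cpos e))
              (((rs ++ [e]).map cpos ++ [((cpos e).1 + (cdir e.2).1, (cpos e).2 + (cdir e.2).2)]).getD (j + 1) (cpos e))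
              (((rs ++ [e]).map cpos ++ [((cpos e).1 + (cdir e.2).1, (cpos e).2 + (cdir e.2).2)]).getD (j + 2) (cpos e)) := by
  have hrs : rs ≠ [] := by rintro rfl; simp at hhead
  have hk : 1 ≤ rs.length := Nat.one_le_iff_ne_zero.2 (fun h => hrs (List.length_eq_zero_iff.1 h))
  -- the extended sequence
  have hle : ∀ m ≤ n, σ m = (nextCorner β)^[m] e := fun m hm => s17_st1_sigma_le hσ hhead hm
  have hsucc : ∀ m ≤ n + rs.length, cpos (σ (m + 1)) = (cornerDart (σ m)).2 := fun m hm =>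
    s17_st1_sigma_succ hσ hhead hchain hlast hm
  have hσN : σ (n + rs.length) = e := by
    rw [hσ, if_neg (show ¬ n + rs.length < n by omega), Nat.add_sub_cancel_left]
    exact (s17_st1_getD_append_cons rs e (nextCorner β e) e).1
  have hσN1 : σ (n + rs.length + 1) = nextCorner β e := by
    rw [hσ, if_neg (show ¬ n + rs.length + 1 < n by omega), show n + rs.length + 1 - n = rs.length + 1 by omega]
    exact (s17_st1_getD_append_cons rs e (nextCorner β e) e).2
  have hper : (fun m => cpos (σ m)) (n + rs.length) = (fun m => cpos (σ m)) 0 := by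
    simp only [hσN, hle 0 (Nat.zero_le _), Function.iterate_zero, id_eq]
  have hper' : (fun m => cpos (σ m)) (n + rs.length + 1) = (fun m => cpos (σ m)) 1 := by
    simp only [hσN1, hle 1 hn, Function.iterate_one]
  -- the darts
  have hcd : cdarts ((List.range (n + rs.length)).map (fun m => cpos (σ m))) =
      (List.range n).map (fun m => cornerDart ((nextCorner β)^[m] e)) ++ rs.map cornerDart := by
    rw [cdarts_map_range _ hper]
    have h1 : (List.range (n + rs.length)).map (fun m => (cpos (σ m), cpos (σ (m + 1)))) =
        (List.range (n + rs.length)).map (fun m => cornerDart (σ m)) := by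
      refine List.map_congr_left fun m hm => ?_
      rw [List.mem_range] at hm
      rw [hsucc m hm.le]
      rfl
    rw [h1, List.range_add, List.map_append, List.map_map]
    congr 1
    · refine List.map_congr_left fun m hm => ?_
      rw [List.mem_range] at hm
      rw [hle m hm.le]
    · apply List.ext_getElem (by simp)
      intro j h1 h2
      simp only [List.length_map, List.length_range] at h1 h2
      simp only [List.getElem_map, List.getElem_range, Function.comp_apply]
      rw [hσ, if_neg (show ¬ n + j < n by omega), Nat.add_sub_cancel_left, List.getD_append _ _ _ _ h2,
        List.getD_eq_getElem _ _ h2]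
  refine ⟨⟨by simp; omega, by rw [hcd]; exact hnodup, fun d hd => ?_⟩, hcd, ?_⟩
  · rw [hcd, List.mem_append, List.mem_map, List.mem_map] at hd
    rcases hd with ⟨m, -, rfl⟩ | ⟨c, -, rfl⟩ <;> exact isDart_cornerDart _
  · -- the turning number
    rw [cturn_map_range _ (by omega) hper hper', Finset.sum_range_add]
    congr 1
    · refine Finset.sum_congr rfl fun m hm => ?_
      rw [Finset.mem_range] at hm
      have e1 : cpos (σ (m + 1)) = cpos (nextCorner β ((nextCorner β)^[m] e)) := by
        rw [hle (m + 1) (Nat.succ_le_of_lt hm), Function.iterate_succ_apply']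
      have e2 : cpos (σ (m + 2)) = cpos (nextCorner β (nextCorner β ((nextCorner β)^[m] e))) := by
        rw [show m + 2 = m + 1 + 1 from rfl, hsucc (m + 1) (by omega), hle (m + 1) (Nat.succ_le_of_lt hm),
          cornerDart_eq β, Function.iterate_succ_apply']
      simp only [hle m hm.le, e1, e2]
      exact turn_cpos β _
    · refine Finset.sum_congr rfl fun j _ => ?_
      have key : ∀ i, cpos (σ (n + i)) =
          ((rs ++ [e]).map cpos ++ [((cpos e).1 + (cdir e.2).1, (cpos e).2 + (cdir e.2).2)]).getD i (cpos e) := by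
        intro i
        rw [hσ, if_neg (show ¬ n + i < n by omega), Nat.add_sub_cancel_left,
          show rs ++ [e, nextCorner β e] = (rs ++ [e]) ++ [nextCorner β e] by simp, ← List.getD_map (f := cpos),
          List.map_append, List.map_singleton, cpos_nextCorner]
      simp only [show n + j + 1 = n + (j + 1) from rfl, show n + j + 2 = n + (j + 2) from rfl, key]

end Generic

/-- **Registered sub-goal `s17_strandTurning_part1`: two strands between the same ends, closed by
a common return walk into closed trails of the oriented medial graph, turn by the same amount as
soon as their partial winding numbers agree on a face beside a dart of the return walk.** For the
turning rules of two configurations `β`, `β'`, a corner `e`, step numbers `n, n' ≥ 1` with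
`(nextCorner β)^[n] e = (nextCorner β')^[n'] e = b`, and a list of corners `rs` starting with `b`
whose darts are consecutive and end at the position of `e`, such that for each strand the darts of
the strand and of `rs` are pairwise distinct: if on the left or right face of the dart of some corner
of `rs` the winding numbers of the two strand dart lists agree, then
`∑_{m<n} turnSign β (σᵐ e) = ∑_{m<n'} turnSign β' (σ'ᵐ e)` (combinatorial Umlaufsatz with the
sign of the winding number, `MedialTrail.inv_of_isTrail`). [cite: Hopf1935, Satz I] -/
theorem s17_strandTurning_part1 : ∀ (β β' : Literature.Probability.Percolation.BondConfig (Literature.Probability.LatticeModels.Site 2)) (e : Literature.Probability.LatticeModels.Site 2 × Fin 4) (n n' : ℕ) (rs : List (Literature.Probability.LatticeModels.Site 2 × Fin 4)), 1 ≤ n → 1 ≤ n' → (Literature.Probability.LatticeModels.nextCorner β)^[n] e = (Literature.Probability.LatticeModels.nextCorner β')^[n'] e → rs.head? = some ((Literature.Probability.LatticeModels.nextCorner β)^[n] e) → List.IsChain (fun c c' => (Literature.Probability.Percolation.cornerDart c).2 = Literature.Probability.LatticeModels.cpos c') rs → (∀ c, rs.getLast? = some c → (Literature.Probability.Percolation.cornerDart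 c).2 = Literature.Probability.LatticeModels.cpos e) → ((List.range n).map (fun m => Literature.Probability.Percolation.cornerDart ((Literature.Probability.LatticeModels.nextCorner β)^[m] e)) ++ rs.map Literature.Probability.Percolation.cornerDart).Nodup → ((List.range n').map (fun m => Literature.Probability.Percolation.cornerDart ((Literature.Probability.LatticeModels.nextCorner β')^[m] e)) ++ rs.map Literature.Probability.Percolation.cornerDart).Nodup → (∃ c ∈ rs, ∃ F : ℤ × ℤ, (F = Literature.Probability.LatticeModels.MedialTrail.lf (Literature.Probability.Percolation.cornerDart c) ∨ F = Literature.Probability.LatticeModels.MedialTrail.rf (Literature.Probability.Percolation.cornerDart c)) ∧ Literature.Probability.LatticeModels.MedialTrail.dwnd ((List.range n).map (fun m => Literature.Probability.Percolation.cornerDart ((Literature.Probability.LatticeModels.nextCorner β)^[m] e))) F = Literature.Probability.LatticeModels.MedialTrail.dwnd ((List.range n').map (fun m => Literature.Probability.Percolation.cornerDart ((Literature.Probability.LatticeModels.nextCorner β')^[m] e))) F) → ∑ m ∈ Finset.range n, Literature.Probability.LatticeModels.turnSign β ((Literature.Probability.LatticeModels.nextCorner β)^[m] e) = ∑ m ∈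 Finset.range n', Literature.Probability.LatticeModels.turnSign β' ((Literature.Probability.LatticeModels.nextCorner β')^[m] e) := by
  intro β β' e n n' rs hn hn' hbb hhead hchain hlast hndA hndB hΔ
  obtain ⟨hTA, hcdA, hctA⟩ := s17_st1_trail
    (σ := fun m => if m < n then (nextCorner β)^[m] e else (rs ++ [e, nextCorner β e]).getD (m - n) e)
    (fun _ => rfl) hn hhead hchain hlast hndA
  obtain ⟨hTB, hcdB, hctB⟩ := s17_st1_trail
    (σ := fun m => if m < n' then (nextCorner β')^[m] e else (rs ++ [e, nextCorner β' e]).getD (m - n') e)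
    (fun _ => rfl) hn' (hbb ▸ hhead) hchain hlast hndB
  set TA := (List.range (n + rs.length)).map (fun m =>
    cpos ((fun m => if m < n then (nextCorner β)^[m] e else (rs ++ [e, nextCorner β e]).getD (m - n) e) m)) with hTAdef
  set TB := (List.range (n' + rs.length)).map (fun m =>
    cpos ((fun m => if m < n' then (nextCorner β')^[m] e else (rs ++ [e, nextCorner β' e]).getD (m - n') e) m)) with hTBdef
  have hIA := inv_of_isTrail _ hTA
  have hIB := inv_of_isTrail _ hTB
  obtain ⟨c, hc, F, hF, hΔ⟩ := hΔ
  have hdA : cornerDart c ∈ cdarts TA := by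
    rw [hcdA]; exact List.mem_append_right _ (List.mem_map_of_mem hc)
  have hdB : cornerDart c ∈ cdarts TB := by
    rw [hcdB]; exact List.mem_append_right _ (List.mem_map_of_mem hc)
  have hAF : wnd TA F = dwnd ((List.range n).map (fun m => cornerDart ((nextCorner β)^[m] e))) F +
      dwnd (rs.map cornerDart) F := by
    rw [wnd, hcdA, dwnd_append]
  have hBF : wnd TB F = dwnd ((List.range n').map (fun m => cornerDart ((nextCorner β')^[m] e))) F +
      dwnd (rs.map cornerDart) F := by
    rw [wnd, hcdB, dwnd_append]
  have hsame : cturn TA = cturn TB := by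
    rcases hIA.rf_cases hTA hdA with ⟨a0, a1, ac, -⟩ | ⟨a0, a1, ac, -⟩ <;>
      rcases hIB.rf_cases hTB hdB with ⟨b0, b1, bc, -⟩ | ⟨b0, b1, bc, -⟩
    · rw [ac, bc]
    · exfalso
      rcases hF with rfl | rfl
      · rw [a1] at hAF; rw [b1] at hBF; omega
      · rw [a0] at hAF; rw [b0] at hBF; omega
    · exfalso
      rcases hF with rfl | rfl
      · rw [a1] at hAF; rw [b1] at hBF; omega
      · rw [a0] at hAF; rw [b0] at hBF; omega
    · rw [ac, bc]
  rw [hctA, hctB] at hsame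
  exact add_right_cancel hsame

end Summit.CriticalPhenomena.CardyFormulaZ2.Cruxes.BoundaryDefectGaussianR.RainbowMonomialsInExcursionKernels
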